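import Literature.NumberTheory.GaloisRepresentations.LAdicCharacterIdelicProofs
import Literature.NumberTheory.GaloisRepresentations.ArtinCharacterLocalGlobalProofs
import HarnessLib

/-!
# The idele class character of an abelian Galois character: local–global compatibility at every place

Topic `NumberTheory/GaloisRepresentations`; namespace `Literature.NumberTheory.GaloisRepresentations`.
A *proofs* file (theorems only; no definition, no named fact, no instance).

`FramedGaloisRep.exists_idelicCharacter` (file `LAdicCharacterIdelicProofs`) attaches to a continuous
character `ψ : Γ_K →ₜ* GL_1(A)` (`A` an ultrametric normed field, e.g. `ℚ̄_ℓ`) the idele class character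
`Ψ = ψ^ab ∘ ( , K) : 𝕀_K → Aˣ` and records its behaviour at the places where `ψ` is UNRAMIFIED.  This
file adds the behaviour at EVERY finite place (`FramedGaloisRep.exists_idelicCharacter_localGlobal`):
for every local Artin map `a : W_{K_v} → K_vˣ` with the characterising clauses `IsLocalArtinMap`
(`LocalClassFieldTheory.lean`; e.g. THE map `canonicalArtin K_v`, `isLocalArtinMap_canonicalArtin_holds`)
and every `w ∈ W_{K_v}`,

  `Ψ(⟨a w⟩_v) = det ψ(res w)⁻¹`,  `res : W_{K_v} ↪ Γ_{K_v} → Γ_K`.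

This is the compatibility of local and global class field theory (Neukirch VI (5.6)) pushed through an
arbitrary continuous abelian `ℓ`-adic character — the composite `φ_ℓ ∘ i_ℓ` of Böckle–Hui §2.3 and of
Serre, *Abelian ℓ-adic representations*, Ch. III §2, through which local algebraicity at `v ∣ ℓ` is read
(in particular the restriction of `ψ` to the inertia group of `K_v` is `u ↦ Ψ(⟨u⟩_v)⁻¹ ∘ a` on
`a⁻¹(𝒪_vˣ)`).  The proof is that of `exists_idelicCharacter` with one more clause: for a representative
`γ` of `(⟨a w⟩_v, K) ∈ Γ_K^ab` and every finite abelian `L ⊆ K̄`, the tree's finite-level compatibility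
`artinIdeleMap_localUnits_mul_absRestrictNormalHom` (`ψ_{L|K}(⟨a w⟩_v) · (res w)|_L = 1`, file
`ArtinCharacterLocalGlobalProofs`) feeds `det_eq_of_forall_artinIdeleMap_eq`.

## References
* J. Neukirch, *Algebraic Number Theory* (1999), Ch. VI §5 Prop. (5.6). [NeukirchANT1999]
* J.-P. Serre, *Abelian ℓ-adic representations and elliptic curves* (1968), Ch. III §2.1–2.3.
  [SerreAbelianLadic1968]
* G. Böckle, C.-Y. Hui, Math. Ann. 393 (2025), §2.3. [BockleHui2025]
-/

noncomputable section

open scoped NumberField Polynomial Topology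
open NumberField IsDedekindDomain IsDedekindDomain.HeightOneSpectrum Field Polynomial Filter

namespace Literature.NumberTheory.GaloisRepresentations

variable {K : Type} [Field K] [NumberField K]
variable {A : Type*} [NormedField A] [IsUltrametricDist A]

open ArtinLocalGlobal in
/-- **The idele class character `Ψ = ψ ∘ Art_K` of an abelian character `ψ : Γ_K → GL_1(A)`, with
local–global compatibility at EVERY finite place.**  There is a continuous `Ψ : 𝕀_K →ₜ* Aˣ`, trivial
on `Kˣ`, with the two properties of `FramedGaloisRep.exists_idelicCharacter` at the places where `ψ` is
unramified (`Ψ(⟨𝒪_vˣ⟩_v) = 1`, `ψ(Frob_v) = Ψ(⟨ϖ⟩_v)`), AND: for every finite place `v`, every local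
Artin map `a : W_{K_v} → K_vˣ` with the characterising clauses `IsLocalArtinMap` (e.g. THE map
`canonicalArtin K_v`) and every `w ∈ W_{K_v}`,

  `Ψ(⟨a w⟩_v) = det ψ (res w)⁻¹`,   `res = absGaloisRestrict K K_v ∘ (W_{K_v} ↪ Γ_{K_v})`

— the composite of BH §2.3 / Serre III §2 through which local algebraicity at the places above `ℓ`
is read.  Proof: `Ψ = ψ^ab ∘ ( , K)` as in `exists_idelicCharacter`; for a representative `γ` of
`(⟨a w⟩_v, K)` and every finite abelian `L ⊆ K̄`, `ψ_{L|K}(⟨a w⟩_v) = ((res w)|_L)⁻¹` is the tree's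
finite-level compatibility `artinIdeleMap_localUnits_mul_absRestrictNormalHom` (Neukirch VI (5.6)),
so `det ψ(γ) = det ψ((res w)⁻¹)` (`det_eq_of_forall_artinIdeleMap_eq`).
[cite: NeukirchANT1999, Ch. VI §5 Prop. (5.6)] [cite: SerreAbelianLadic1968, Ch. III §2.1–2.3]
[cite: BockleHui2025, §2.3] -/
theorem FramedGaloisRep.exists_idelicCharacter_localGlobal (ψ : FramedGaloisRep K A 1) :
    ∃ Ψ : ideleGroup K →ₜ* Aˣ,
      (∀ x ∈ principalIdeles K, Ψ x = 1) ∧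
      (∀ v : HeightOneSpectrum (𝓞 K), ψ.IsUnramifiedAt v →
        (∀ u : (v.adicCompletionIntegers K)ˣ,
            Ψ (localUnits v (Units.map ((v.adicCompletionIntegers K).subtype : _ →* _) u)) = 1) ∧
        ∀ ϖ : (v.adicCompletion K)ˣ,
          Valued.v (ϖ : v.adicCompletion K) = WithZero.exp (-1 : ℤ) →
            ψ.HasFrobCharpolyAt v (X - C ((Ψ (localUnits v ϖ) : Aˣ) : A))) ∧
      ∀ (v : HeightOneSpectrum (𝓞 K)) (a : WeilGroup (v.adicCompletion K) →* (v.adicCompletion K)ˣ),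
        IsLocalArtinMap (v.adicCompletion K) a → ∀ w : WeilGroup (v.adicCompletion K),
          Ψ (localUnits v (a w)) =
            (FramedRep.det ψ (absGaloisRestrict K (v.adicCompletion K)
              (WeilGroup.toAbsGalois (v.adicCompletion K) w)))⁻¹ := by
  classical
  set hR : artinReciprocity_character := artinReciprocity_character_holds with hRdef
  set χ : absoluteGaloisGroup K →ₜ* Aˣ := FramedRep.det ψ with hχdef
  -- `χ` factors through `Γ_K^ab = Γ_K ⧸ closure [Γ_K, Γ_K]`
  have hC : (commutator (absoluteGaloisGroup K)).topologicalClosure ≤ χ.toMonoidHom.ker := by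
    refine Subgroup.topologicalClosure_minimal _ (Abelianization.commutator_subset_ker _) ?_
    rw [MonoidHom.coe_ker]
    exact isClosed_singleton.preimage χ.continuous
  set χab : absoluteGaloisGroupAbelianization K →* Aˣ :=
    QuotientGroup.lift (commutator (absoluteGaloisGroup K)).topologicalClosure χ.toMonoidHom hC
    with hχabdef
  have hχab : ∀ γ : absoluteGaloisGroup K, χab (absGaloisAbProj K γ) = χ γ := fun γ => rfl
  have hχabc : Continuous χab := by
    rw [(QuotientGroup.isQuotientMap_mk
      (commutator (absoluteGaloisGroup K)).topologicalClosure).continuous_iff]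
    exact χ.continuous
  -- the universal norm residue symbol
  set hω := isCompatibleSystem_artinMapFamily (K := K) hR with hωdef
  have hθc : Continuous hω.theta := continuous_theta_artinMapFamily hR
  -- the character `Ψ`
  set Ψ₀ : ideleGroup K →* Aˣ :=
    χab.comp (hω.theta.comp (QuotientGroup.mk' (principalIdeles K))) with hΨ₀def
  have hΨ₀c : Continuous Ψ₀ :=
    hχabc.comp (hθc.comp (QuotientGroup.continuous_mk (N := principalIdeles K)))
  set Ψ : ideleGroup K →ₜ* Aˣ := ⟨Ψ₀, hΨ₀c⟩ with hΨdef
  have hΨapply : ∀ x : ideleGroup K, Ψ x = χab (hω.theta (QuotientGroup.mk x)) := fun x => rfl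
  -- evaluation through representatives
  have hΨrep : ∀ x : ideleGroup K, ∃ γ : absoluteGaloisGroup K,
      Ψ x = χ γ ∧ γ ∈ hω.Reps (QuotientGroup.mk x) := fun x => by
    obtain ⟨γ, hγ, hγr⟩ := hω.exists_absGaloisAbProj_eq_theta (QuotientGroup.mk x)
    refine ⟨γ, ?_, hγr⟩
    rw [hΨapply, ← hγ, hχab]
  refine ⟨Ψ, fun x hx => ?_, fun v hv => ?_, fun v a ha w => ?_⟩
  · rw [hΨapply, (QuotientGroup.eq_one_iff x).mpr hx, map_one, map_one]
  · -- at `v` unramified for `ψ`, all inertia above `v` dies wherever `ker ψ` does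
    have hI : ∀ (L : IntermediateField K (AlgebraicClosure K)) [FiniteDimensional K L]
        [IsAbelianGalois K L],
        (∀ σ : absoluteGaloisGroup K, ψ σ = 1 → absRestrictNormalHom L σ = 1) →
        ∀ 𝔓 ∈ v.primesAbove, ∀ σ ∈ 𝔓.inertia (absoluteGaloisGroup K),
          absRestrictNormalHom L σ = 1 :=
      fun L _ _ hL 𝔓 h𝔓 σ hσ => hL σ (hv 𝔓 h𝔓 σ hσ)
    refine ⟨fun u => ?_, fun ϖ hϖ => ?_⟩
    · obtain ⟨γ, hΨγ, hγr⟩ :=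
        hΨrep (localUnits v (Units.map ((v.adicCompletionIntegers K).subtype : _ →* _) u))
      have h1 : χ γ = χ 1 :=
        FramedGaloisRep.det_eq_of_forall_artinIdeleMap_eq hR ψ hγr fun L _ _ _ hL => by
          rw [map_one]
          exact artinIdeleMap_localUnits_integer_of_forall_inertia L hR (hI L hL) u
      rw [hΨγ, h1, map_one]
    · obtain ⟨γ, hΨγ, hγr⟩ := hΨrep (localUnits v ϖ)
      refine (FramedGaloisRep.hasFrobCharpolyAt_iff_of_rank_one ψ v _).mpr fun 𝔓 h𝔓 Φ hΦ => ?_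
      have h1 : χ γ = χ Φ :=
        FramedGaloisRep.det_eq_of_forall_artinIdeleMap_eq hR ψ hγr fun L _ _ _ hL =>
          artinIdeleMap_localUnits_eq_absRestrictNormalHom L hR (hI L hL) hϖ h𝔓 hΦ
      rw [hΨγ, h1, hχdef, FramedGaloisRep.coe_det_apply_of_rank_one]
  · -- local–global compatibility at every place: `ψ_{L|K}(⟨a w⟩_v) = ((res w)|_L)⁻¹` for all `L`
    obtain ⟨γ, hΨγ, hγr⟩ := hΨrep (localUnits v (a w))
    have h1 : χ γ = χ (absGaloisRestrict K (v.adicCompletion K)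
        (WeilGroup.toAbsGalois (v.adicCompletion K) w))⁻¹ :=
      FramedGaloisRep.det_eq_of_forall_artinIdeleMap_eq hR ψ hγr fun L _ _ _ _ => by
        rw [map_inv, ← mul_eq_one_iff_eq_inv]
        exact artinIdeleMap_localUnits_mul_absRestrictNormalHom v L ha w
    rw [hΨγ, h1, map_inv]

end Literature.NumberTheory.GaloisRepresentations

end
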